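import Literature.NumberTheory.EllipticCurves.ModularCurve
import Mathlib.NumberTheory.ModularForms.LevelOne.DimensionFormula
import Mathlib.NumberTheory.ModularForms.ProperlyDiscontinuous
import HarnessLib

/-!
# `dim S₂(Γ₀(N)) = g(X₀(N))`: decomposition of the fact `finrank_cuspForm_two_eq_genusX0`
  (trunk EllArithM, item C17, sibling of `ModularCurve.lean`)

D-0014 keeps `Literature/` sorry-free by stating cited results as named facts `def X : Prop`.
The fact `Literature.ModularForms.finrank_cuspForm_two_eq_genusX0 N`
(`dim_ℂ S₂(Γ₀(N)) = genusX0 N`, Diamond–Shurman Thm. 3.5.1) of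
`Literature.NumberTheory.EllipticCurves.ModularCurve` compares Mathlib's space of weight-`2` cusp
forms with the *closed formula* `genusX0 N = (12 + μ − 3ν₂ − 4ν₃ − 6ν_∞)/12`. Its printed proof
(Diamond–Shurman, *A first course in modular forms*, Ch. 2–3) has the following architecture,
which this file records as a DAG of named sub-facts together with the **proved** assembly step:

1. (`twelve_mul_finrank_cuspForm_two Γ`, Diamond–Shurman Thm. 3.1.1 with Thm. 3.5.1, `k = 2`)
   For a congruence subgroup `Γ ≤ SL₂(ℤ)`, `X(Γ)` is a compact Riemann surface of genus
   `g = 1 + d/12 − ε₂/4 − ε₃/3 − ε_∞/2` (Riemann–Hurwitz for `X(Γ) → X(1) ≅ ℙ¹`, Thm. 3.1.1),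
   where `d = [SL₂(ℤ) : {±I}Γ]`, `ε₂, ε₃` are the numbers of elliptic points of period `2, 3`
   and `ε_∞` the number of cusps; and `dim S₂(Γ) = g` (Thm. 3.5.1 for `k = 2`: weight-`2` cusp
   forms are the holomorphic differentials on `X(Γ)`, §3.3, whose space has dimension `g` by
   Riemann–Roch, Cor. 3.4.2). Mathlib (pin v4.32.0) has neither the complex structure on
   `Γ\ℍ*` nor Riemann–Roch, so the genus `g` is eliminated between the two theorems and the
   combination `12 · dim S₂(Γ) + 3ε₂ + 4ε₃ + 6ε_∞ = 12 + d` is vendored as one named fact, over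
   the definitions `adjoinNegI Γ = {±I}Γ`, `ellipticPeriod` (the period `h_τ`, §2.2) and
   `ellipticPointCount Γ h = ε_h(Γ)` (§3.1) made here, and Mathlib's `CuspOrbits` for `ε_∞`.
2. (`ellipticPointCount_two_gamma0 N`, `ellipticPointCount_three_gamma0 N`; Diamond–Shurman
   §3.7, (3.14)–(3.15), Ex. 3.7.6) `ε₂(Γ₀(N)) = #{n mod N | n² + 1 ≡ 0} = nu₂ N` and
   `ε₃(Γ₀(N)) = #{n mod N | n² − n + 1 ≡ 0} = nu₃ N`.
3. (`numCusps_eq_nuInfty N`, in `ModularCurve.lean`; Shimura Prop. 1.43, Diamond–Shurman §3.8)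
   `ε_∞(Γ₀(N)) = ∑_{d ∣ N} φ(gcd(d, N/d))`.
4. (`index_gamma0_eq_gamma0Index N`, in `ModularCurve.lean`; Shimura Prop. 1.43) together with
   `−I ∈ Γ₀(N)` (`adjoinNegI_gamma0`, proved): `d(Γ₀(N)) = [SL₂(ℤ) : Γ₀(N)] = ∏ p^{e−1}(p + 1)`.
5. (proved here: `twelve_mul_finrank_cuspForm_two_gamma0`, `finrank_cuspForm_two_eq_genusX0_of`,
   `twelve_mul_genusX0_of`) items 1–4 give `12 · dim S₂(Γ₀(N)) + 3ν₂ + 4ν₃ + 6ν_∞ = 12 + μ`,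
   hence the `ℕ`-subtraction and the division by `12` in `genusX0 N` are exact and
   `dim S₂(Γ₀(N)) = genusX0 N`, i.e. `finrank_cuspForm_two_eq_genusX0 N`, and also the fact
   `twelve_mul_genusX0 N` of `ModularCurve.lean`.
6. (proved here, unconditionally: `finrank_cuspForm_two_eq_genusX0_one`) the level-one instance
   `dim S₂(SL₂(ℤ)) = 0 = genusX0 1`, from Mathlib's `CuspForm.rank_eq_zero_of_weight_lt_twelve`
   (Diamond–Shurman Thm. 3.5.2); a non-vacuity check of the statement.

The fact `finrank_cuspForm_two_eq_genusX0` elaborates to `ℕ → Prop` (its `[NeZero N]` section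
variable is unused by the body and hence not part of the definition); at `N = 0` it is junk
(`Γ₀(0)` is the Borel subgroup, of infinite index, and `genusX0 0 = 13/12 = 1`), so every
discharge here assumes `[NeZero N]`, as the source does (`N` a positive integer).

## References

* F. Diamond, J. Shurman, *A first course in modular forms*, GTM 228, Springer (2005), §2.2
  (elliptic points, periods), §2.3 (Cor. 2.3.5), §3.1 (Thm. 3.1.1), §3.5 (Thm. 3.5.1, 3.5.2),
  §3.7 (Prop. 3.7.1, Cor. 3.7.2, (3.14), (3.15), Ex. 3.7.6), §3.8, §3.9 (Figure 3.3).
* G. Shimura, *Introduction to the arithmetic theory of automorphic functions* (1971),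
  Prop. 1.40, 1.43, Thm. 2.24.
-/

noncomputable section

open scoped MatrixGroups ModularForm

open CongruenceSubgroup UpperHalfPlane Matrix.SpecialLinearGroup

namespace Literature.NumberTheory.EllipticCurves.ModularForms

/-! ### `{±I}Γ`, periods and elliptic points -/

section EllipticPoints

/-- Only finitely many elements of `SL₂(ℤ)` fix a given point of `ℍ`: `SL₂(ℤ)` acts properly
discontinuously on `ℍ` (Mathlib, for its image `𝒮ℒ ≤ GL(2, ℝ)`), in particular isotropy groups
are finite (Diamond–Shurman Prop. 2.1.1, Cor. 2.3.5). [folklore] -/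
theorem finite_setOf_smul_eq (τ : ℍ) : {γ : SL(2, ℤ) | γ • τ = τ}.Finite := by
  refine ((ProperlyDiscontinuousSMul.finite_stabilizer' 𝒮ℒ τ).preimage
    (f := fun γ : SL(2, ℤ) ↦ (⟨mapGL ℝ γ, γ, rfl⟩ : 𝒮ℒ)) ?_).subset fun γ hγ ↦ hγ
  exact fun a _ b _ hab ↦ mapGL_injective (congrArg Subtype.val hab)

/-- The isotropy subgroup `Γ_τ` of a point `τ ∈ ℍ` in a subgroup `Γ ≤ SL₂(ℤ)` is finite
(Diamond–Shurman Cor. 2.3.5). [folklore] -/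
theorem finite_stabilizer (Γ : Subgroup SL(2, ℤ)) (τ : ℍ) : Finite (MulAction.stabilizer Γ τ) :=
  have := (finite_setOf_smul_eq τ).to_subtype
  Finite.of_injective
    (fun γ : MulAction.stabilizer Γ τ ↦ (⟨(γ : Γ), γ.2⟩ : {γ : SL(2, ℤ) | γ • τ = τ}))
    fun a b hab ↦ Subtype.ext <| Subtype.ext <| by simpa using congrArg Subtype.val hab

variable (Γ : Subgroup SL(2, ℤ))

/-- The subgroup `{±I}Γ ≤ SL₂(ℤ)` generated by `Γ` and `−I`: the matrices `γ` with `γ ∈ Γ` or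
`−γ ∈ Γ`. Since `−I` acts trivially on `ℍ`, `Γ` and `{±I}Γ` define the same transformation
group of `ℍ` and the same curve `Y(Γ)`; `d = [SL₂(ℤ) : {±I}Γ]` is the degree of `X(Γ) → X(1)`
(Diamond–Shurman §2.2, §3.1). Its image in `GL(2, ℝ)` is Mathlib's `Subgroup.adjoinNegOne` of
the image of `Γ`. [cite: DiamondShurman2005, §3.1] -/
def adjoinNegI : Subgroup SL(2, ℤ) where
  carrier := {γ | γ ∈ Γ ∨ -γ ∈ Γ}
  mul_mem' := by
    rintro a b (ha | ha) (hb | hb)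
    · exact Or.inl (mul_mem ha hb)
    · exact Or.inr (by simpa only [mul_neg] using mul_mem ha hb)
    · exact Or.inr (by simpa only [neg_mul] using mul_mem ha hb)
    · exact Or.inl (by simpa only [neg_mul_neg] using mul_mem ha hb)
  one_mem' := Or.inl (one_mem Γ)
  inv_mem' := by
    rintro a (ha | ha)
    · exact Or.inl (inv_mem ha)
    · exact Or.inr (by simpa only [inv_neg] using inv_mem ha)

variable {Γ}

/-- Membership in `{±I}Γ` (Diamond–Shurman §3.1). [folklore] -/
@[simp]
theorem mem_adjoinNegI_iff {γ : SL(2, ℤ)} : γ ∈ adjoinNegI Γ ↔ γ ∈ Γ ∨ -γ ∈ Γ :=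
  Iff.rfl

/-- `Γ ≤ {±I}Γ` (Diamond–Shurman §3.1). [folklore] -/
theorem le_adjoinNegI : Γ ≤ adjoinNegI Γ := fun _ h ↦ Or.inl h

/-- `−I ∈ {±I}Γ` (Diamond–Shurman §3.1). [folklore] -/
theorem neg_one_mem_adjoinNegI : -1 ∈ adjoinNegI Γ :=
  Or.inr (by simpa only [neg_neg] using one_mem Γ)

/-- `{±I}Γ = Γ` when `−I ∈ Γ` (Diamond–Shurman §3.1). [folklore] -/
theorem adjoinNegI_eq_self_of_neg_one_mem (h : -1 ∈ Γ) : adjoinNegI Γ = Γ :=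
  le_antisymm (fun γ hγ ↦ hγ.elim id fun h' ↦ by simpa using mul_mem h h') le_adjoinNegI

/-- `−I ∈ Γ₀(N)`, so `{±I}Γ₀(N) = Γ₀(N)` and the degree of `X₀(N) → X(1)` is `[SL₂(ℤ) : Γ₀(N)]`
(Diamond–Shurman §3.9). [folklore] -/
theorem adjoinNegI_gamma0 (N : ℕ) : adjoinNegI (Gamma0 N) = Gamma0 N :=
  adjoinNegI_eq_self_of_neg_one_mem (by simp [Gamma0_mem])

/-- `SL(2, ℤ) → GL(2, ℝ)` commutes with negation. [folklore] -/
theorem mapGL_neg (γ : SL(2, ℤ)) : mapGL ℝ (-γ) = -mapGL ℝ γ := by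
  ext i j
  simp

variable (Γ) in
/-- The image of `{±I}Γ` in `GL(2, ℝ)` (Mathlib's coercion of subgroups of `SL(2, ℤ)` along
`mapGL ℝ`) is Mathlib's `Subgroup.adjoinNegOne` of the image of `Γ`: `adjoinNegI` is the
`SL(2, ℤ)`-level version of that construction, needed to speak of the index in `SL(2, ℤ)`.
[folklore] -/
theorem coe_adjoinNegI :
    (adjoinNegI Γ : Subgroup (GL (Fin 2) ℝ)) = (Γ : Subgroup (GL (Fin 2) ℝ)).adjoinNegOne := by
  ext g
  constructor
  · rintro ⟨γ, hγ | hγ, rfl⟩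
    · exact Or.inl ⟨γ, hγ, rfl⟩
    · exact Or.inr ⟨-γ, hγ, mapGL_neg γ⟩
  · rintro (⟨γ, hγ, rfl⟩ | ⟨γ, hγ, h⟩)
    · exact ⟨γ, le_adjoinNegI hγ, rfl⟩
    · exact ⟨-γ, Or.inr (by rw [neg_neg]; exact hγ), by rw [mapGL_neg, h, neg_neg]⟩

variable (Γ)

/-- The **period** `h_τ = |{±I}Γ_τ / {±I}| = |{±I}Γ_τ| / 2` of a point `τ ∈ ℍ` with respect to
`Γ`: the number of transformations of `ℍ` induced by elements of `Γ` fixing `τ` (the isotropy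
subgroup `{±I}Γ_τ` is finite cyclic of order `2`, `4` or `6`, Diamond–Shurman Cor. 2.3.5, so
`h_τ ∈ {1, 2, 3}`); `τ` is an **elliptic point** of `Γ` when `h_τ > 1`. Written with the
stabiliser of `τ` in `{±I}Γ` for Mathlib's action of `SL(2, ℤ)` on `UpperHalfPlane`.
[cite: DiamondShurman2005, §2.2] -/
def ellipticPeriod (τ : ℍ) : ℕ :=
  Nat.card (MulAction.stabilizer (adjoinNegI Γ) τ) / 2

/-- `2 h_τ = |{±I}Γ_τ|`: the isotropy subgroup is finite and contains the subgroup `{±I}` of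
order `2`, so the division in `ellipticPeriod` is exact (Diamond–Shurman §2.3, Cor. 2.3.5).
[folklore] -/
theorem two_mul_ellipticPeriod (τ : ℍ) :
    2 * ellipticPeriod Γ τ = Nat.card (MulAction.stabilizer (adjoinNegI Γ) τ) := by
  have := finite_stabilizer (adjoinNegI Γ) τ
  -- `-I` as an element of the isotropy subgroup; it has order `2`
  let g : MulAction.stabilizer (adjoinNegI Γ) τ :=
    ⟨⟨-1, neg_one_mem_adjoinNegI⟩, by
      rw [MulAction.mem_stabilizer_iff, Subgroup.mk_smul, ModularGroup.SL_neg_smul, one_smul]⟩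
  have hg : orderOf g = 2 := by
    refine orderOf_eq_prime (Subtype.ext <| Subtype.ext <| by simp [g, sq]) fun h ↦ ?_
    have h' := congrArg (fun x : MulAction.stabilizer (adjoinNegI Γ) τ ↦ ((x : adjoinNegI Γ) :
      SL(2, ℤ)) 0 0) h
    simp [g] at h'
  have hdvd : orderOf g ∣ Nat.card (MulAction.stabilizer (adjoinNegI Γ) τ) := orderOf_dvd_natCard g
  rw [hg] at hdvd
  exact Nat.mul_div_cancel' hdvd

/-- Periods are positive: `h_τ ≥ 1` (Diamond–Shurman §2.3). [folklore] -/
theorem ellipticPeriod_pos (τ : ℍ) : 0 < ellipticPeriod Γ τ := by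
  have := finite_stabilizer (adjoinNegI Γ) τ
  have h := two_mul_ellipticPeriod Γ τ
  have : 0 < Nat.card (MulAction.stabilizer (adjoinNegI Γ) τ) := Nat.card_pos
  omega

/-- The period is constant on `{±I}Γ`-orbits (conjugate points have conjugate isotropy groups;
Diamond–Shurman §2.2, Ex. 2.2.3). [folklore] -/
theorem ellipticPeriod_smul_of_mem {γ : SL(2, ℤ)} (hγ : γ ∈ adjoinNegI Γ) (τ : ℍ) :
    ellipticPeriod Γ (γ • τ) = ellipticPeriod Γ τ := by
  have e := MulAction.stabilizerEquivStabilizer (G := adjoinNegI Γ) (g := ⟨γ, hγ⟩) (a := τ)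
    (b := γ • τ) rfl
  unfold ellipticPeriod
  rw [Nat.card_congr e.toEquiv]

/-- The period as a function on the open modular curve `Y(Γ) = Γ\ℍ` (well defined by
`ellipticPeriod_smul_of_mem`; Diamond–Shurman §2.2). [cite: DiamondShurman2005, §2.2] -/
def orbitPeriod : MulAction.orbitRel.Quotient Γ ℍ → ℕ :=
  Quotient.lift (ellipticPeriod Γ) fun _ τ' h ↦ by
    obtain ⟨γ, rfl⟩ := h
    exact ellipticPeriod_smul_of_mem Γ (le_adjoinNegI γ.2) τ'

/-- `orbitPeriod` on an orbit `Γτ` is the period of `τ`. [folklore] -/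
@[simp]
theorem orbitPeriod_mk (τ : ℍ) :
    orbitPeriod Γ (Quotient.mk _ τ : MulAction.orbitRel.Quotient Γ ℍ) = ellipticPeriod Γ τ :=
  rfl

/-- `ε_h(Γ)`: the number of points of `Y(Γ) = Γ\ℍ` of period `h`; for `h = 2, 3` this is the
number of **elliptic points of period `h`** of `X(Γ)` (finite, Diamond–Shurman Cor. 2.3.5; the
cusps are not elliptic points). Only `h = 2, 3` are used; for `h = 1` the set is infinite and the
value is `Nat.card`'s junk `0`, for `h ∉ {1, 2, 3}` the set is empty.
[cite: DiamondShurman2005, §3.1] -/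
def ellipticPointCount (h : ℕ) : ℕ :=
  Nat.card {y : MulAction.orbitRel.Quotient Γ ℍ // orbitPeriod Γ y = h}

end EllipticPoints

/-! ### Named sub-facts -/

section Facts

/-- **Genus and dimension formula combined** (Diamond–Shurman Thm. 3.1.1 with Thm. 3.5.1 for
`k = 2`). For a congruence subgroup `Γ` of `SL₂(ℤ)`,
`12 · dim_ℂ S₂(Γ) + 3 ε₂ + 4 ε₃ + 6 ε_∞ = 12 + d`, where `d = [SL₂(ℤ) : {±I}Γ]` is the degree of
`X(Γ) → X(1)`, `ε₂, ε₃` are the numbers of elliptic points of period `2, 3` of `X(Γ)` and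
`ε_∞ = #Γ\ℙ¹(ℚ)` is its number of cusps (Mathlib `CuspOrbits`). This is
`dim S₂(Γ) = g` (Thm. 3.5.1, `k = 2`) with the genus `g = 1 + d/12 − ε₂/4 − ε₃/3 − ε_∞/2` of
`X(Γ)` (Thm. 3.1.1) substituted and denominators cleared; the genus itself is not a Lean notion
yet (no compact Riemann surface `X(Γ)` in Mathlib), which is why the two theorems are vendored
as one statement. Finite-dimensionality of `S₂(Γ)`, also part of Thm. 3.5.1, is not asserted.
[cite: DiamondShurman2005, Thm. 3.5.1 with Thm. 3.1.1] -/
def twelve_mul_finrank_cuspForm_two (Γ : Subgroup SL(2, ℤ)) : Prop :=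
  IsCongruenceSubgroup Γ →
    12 * Module.finrank ℂ (CuspForm Γ 2) + 3 * ellipticPointCount Γ 2 +
        4 * ellipticPointCount Γ 3 + 6 * Nat.card (CuspOrbits Γ) =
      12 + (adjoinNegI Γ).index

variable (N : ℕ)

/-- **Elliptic points of period `2` on `X₀(N)`** (Diamond–Shurman (3.15), Ex. 3.7.6(d), from
Prop. 3.7.1): they are exactly the orbits `Γ₀(N)(n + i)/(n² + 1)` for `n mod N` with
`n² + 1 ≡ 0 (mod N)`, pairwise distinct; hence `ε₂(Γ₀(N)) = #{n mod N | n² + 1 ≡ 0} = nu₂ N`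
(whose closed form is Cor. 3.7.2). [cite: DiamondShurman2005, §3.7 (3.15)] -/
def ellipticPointCount_two_gamma0 : Prop :=
  ellipticPointCount (Gamma0 N) 2 = nu₂ N

/-- **Elliptic points of period `3` on `X₀(N)`** (Diamond–Shurman (3.14), Ex. 3.7.6(b,c), from
Prop. 3.7.1): they are exactly the orbits `Γ₀(N)(n + μ₃)/(n² − n + 1)` for `n mod N` with
`n² − n + 1 ≡ 0 (mod N)`, pairwise distinct; hence
`ε₃(Γ₀(N)) = #{n mod N | n² − n + 1 ≡ 0} = #{x mod N | x² + x + 1 ≡ 0} = nu₃ N` (substitute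
`x = −n`; closed form Cor. 3.7.2). [cite: DiamondShurman2005, §3.7 (3.14)] -/
def ellipticPointCount_three_gamma0 : Prop :=
  ellipticPointCount (Gamma0 N) 3 = nu₃ N

end Facts

/-! ### Assembly: the dimension formula for `Γ₀(N)` from the sub-facts -/

section Assembly

variable (N : ℕ) [NeZero N]

/-- Items 1–4 of the DAG give `12 · dim S₂(Γ₀(N)) + 3ν₂ + 4ν₃ + 6ν_∞ = 12 + μ`
(Diamond–Shurman Thm. 3.1.1, 3.5.1 with the data of Figure 3.3 for `Γ₀(N)`; `−I ∈ Γ₀(N)` so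
`d = [SL₂(ℤ) : Γ₀(N)] = μ`). [cite: DiamondShurman2005, §3.9 Figure 3.3] -/
theorem twelve_mul_finrank_cuspForm_two_gamma0 (h₁ : twelve_mul_finrank_cuspForm_two (Gamma0 N))
    (h₂ : ellipticPointCount_two_gamma0 N) (h₃ : ellipticPointCount_three_gamma0 N)
    (h₄ : numCusps_eq_nuInfty N) (h₅ : index_gamma0_eq_gamma0Index N) :
    12 * Module.finrank ℂ (CuspForm (Gamma0 N) 2) + 3 * nu₂ N + 4 * nu₃ N + 6 * nuInfty N =
      12 + gamma0Index N := by
  have h := h₁ (Gamma0_is_congruence N)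
  rw [adjoinNegI_gamma0] at h
  have h₂' : ellipticPointCount (Gamma0 N) 2 = nu₂ N := h₂
  have h₃' : ellipticPointCount (Gamma0 N) 3 = nu₃ N := h₃
  have h₄' : Nat.card (CuspOrbits (Gamma0 N)) = nuInfty N := h₄
  have h₅' : (Gamma0 N).index = gamma0Index N := h₅
  rwa [h₂', h₃', h₄', h₅'] at h

/-- **`dim S₂(Γ₀(N)) = g(X₀(N))` from the sub-facts**: the fact `finrank_cuspForm_two_eq_genusX0 N`
of `ModularCurve.lean` follows from items 1–4 of the DAG, the closed formula `genusX0 N` being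
exact by `twelve_mul_finrank_cuspForm_two_gamma0` (Diamond–Shurman Thm. 3.5.1).
[cite: DiamondShurman2005, Thm. 3.5.1] -/
theorem finrank_cuspForm_two_eq_genusX0_of (h₁ : twelve_mul_finrank_cuspForm_two (Gamma0 N))
    (h₂ : ellipticPointCount_two_gamma0 N) (h₃ : ellipticPointCount_three_gamma0 N)
    (h₄ : numCusps_eq_nuInfty N) (h₅ : index_gamma0_eq_gamma0Index N) :
    finrank_cuspForm_two_eq_genusX0 N := by
  have h := twelve_mul_finrank_cuspForm_two_gamma0 N h₁ h₂ h₃ h₄ h₅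
  unfold finrank_cuspForm_two_eq_genusX0 genusX0
  omega

/-- **Exact genus formula from the sub-facts**: the fact `twelve_mul_genusX0 N` of
`ModularCurve.lean` (`12 g + 3ν₂ + 4ν₃ + 6ν_∞ = 12 + μ` for the closed formula `g = genusX0 N`)
follows from items 1–4 of the DAG (Shimura Prop. 1.40; Diamond–Shurman Thm. 3.1.1).
[cite: DiamondShurman2005, Thm. 3.1.1] -/
theorem twelve_mul_genusX0_of (h₁ : twelve_mul_finrank_cuspForm_two (Gamma0 N))
    (h₂ : ellipticPointCount_two_gamma0 N) (h₃ : ellipticPointCount_three_gamma0 N)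
    (h₄ : numCusps_eq_nuInfty N) (h₅ : index_gamma0_eq_gamma0Index N) :
    twelve_mul_genusX0 N := by
  have h := twelve_mul_finrank_cuspForm_two_gamma0 N h₁ h₂ h₃ h₄ h₅
  unfold twelve_mul_genusX0 genusX0
  omega

end Assembly

/-! ### Level one, unconditionally -/

section LevelOne

/-- `Γ₀(1) = SL₂(ℤ)`. [folklore] -/
theorem gamma0_one_eq_top : Gamma0 1 = ⊤ := by
  ext A
  simp only [Gamma0_mem, Subgroup.mem_top, iff_true]
  exact Subsingleton.elim _ _

/-- The image of `Γ₀(1)` in `GL(2, ℝ)` is Mathlib's `𝒮ℒ`, the image of `SL(2, ℤ)`. [folklore] -/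
theorem coe_gamma0_one : (Gamma0 1 : Subgroup (GL (Fin 2) ℝ)) = 𝒮ℒ := by
  rw [gamma0_one_eq_top, ← Gamma_one_top, Gamma_one_coe_eq_SL]

/-- Spaces of cusp forms of equal levels (equal as subgroups of `GL(2, ℝ)`) have equal
dimension; used to transport Mathlib's level-one results, stated for `𝒮ℒ`, to `Γ₀(1)`.
[folklore] -/
theorem finrank_cuspForm_congr {Γ Γ' : Subgroup (GL (Fin 2) ℝ)} (h : Γ = Γ') (k : ℤ)
    [Γ.HasDetOne] [Γ'.HasDetOne] :
    Module.finrank ℂ (CuspForm Γ k) = Module.finrank ℂ (CuspForm Γ' k) := by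
  subst h
  rfl

/-- `genusX0 1 = (12 + 1 − 3 − 4 − 6)/12 = 0`: `μ = 1`, `ν₂ = ν₃ = ν_∞ = 1` at level `1`
(Diamond–Shurman §3.1: `X(1)` has genus `0`). [folklore] -/
theorem genusX0_one : genusX0 1 = 0 := by
  have h₂ : nu₂ 1 = 1 := by
    unfold nu₂
    rw [Nat.card_congr (Equiv.subtypeUnivEquiv fun x ↦ Subsingleton.elim _ _), Nat.card_unique]
  have h₃ : nu₃ 1 = 1 := by
    unfold nu₃
    rw [Nat.card_congr (Equiv.subtypeUnivEquiv fun x ↦ Subsingleton.elim _ _), Nat.card_unique]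
  simp [genusX0, gamma0Index, nuInfty, h₂, h₃]

/-- **`dim S₂(SL₂(ℤ)) = 0 = g(X(1))`**: the level-one instance of
`finrank_cuspForm_two_eq_genusX0`, unconditionally, from Mathlib's
`CuspForm.rank_eq_zero_of_weight_lt_twelve` (Diamond–Shurman Thm. 3.5.2: `S_k(SL₂(ℤ)) = 0` for
`k < 12`). [cite: DiamondShurman2005, Thm. 3.5.2] -/
theorem finrank_cuspForm_two_eq_genusX0_one : finrank_cuspForm_two_eq_genusX0 1 := by
  unfold finrank_cuspForm_two_eq_genusX0
  rw [genusX0_one, finrank_cuspForm_congr coe_gamma0_one]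
  exact Module.finrank_eq_of_rank_eq
    (by simpa using CuspForm.rank_eq_zero_of_weight_lt_twelve (k := 2) (by norm_num))

end LevelOne

end Literature.NumberTheory.EllipticCurves.ModularForms

end
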